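import Summits.AtomisticToContinuum.BoseEinsteinCondensation.Theorems.BECGroundStateSOSPeriodicIRBoundTwoSectorPairDefs
import HarnessLib

/-!
# Route `BECGroundStateSOS`, crux `PeriodicIRBound` (stmt-AtomisticToContinuum-3972), line `two-sector-gd-transfer` (v11) —
# stub S11a `stub_exchangeCondensateBound : ExchangeCondensateBound`

Supports (does not close) stmt-AtomisticToContinuum-3972. Lead seat c23 (`Cruxes/PeriodicIRBound/SOFT-LOCATION.md`, Step 3).
ELEMENTARY: the exchange coefficient `E = exchCoef w L k Φ` of a continuous `(m+1)`-body `Φ` is condensate-dominated,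
`(m+1)·Re E ≥ v̂_L(p)·n₀/L³ − ‖w‖₁((m+1)‖Φ‖² − n₀)/L³`, `p = 2πk/L`, `n₀ = ‖a_0Φ‖²`.

Proof. Split slot `0` into mean and fluctuation, `Φ = g₁ + Φ₂`, `g₁(X) = φ_0(x₀)·c(X̂₀)`, `c = sliceCoef L 0 Φ`
(`∫_{x₀} Φ₂ = 0`). In the pair-integral form `E = ∫_{Λ^{m+2}} w^per(Z₀−Z₁) B_Φ(Z)` (`WF.piece_pair`) the difference
`B_Φ − B_{Φ₂}` is the sum of two cross terms; both are computed by peeling the first particle (`WF.integral_cellN_succ`) and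
the eigenfunction property of the plane wave under convolution with the `Lℤ³`-periodic, even weight,
`∫_Λ w^per(y−x) conj φ_k(x) φ_k(y) dy = L⁻³ ∫_Λ w^per e_k` (shift invariance of cell integrals of periodic functions), one of
them after relabelling the particles `0 ↔ 1` (`WF.integral_cellN_comp_perm`): the first gives `L⁻³ conj(∫_Λ w^per e_k)·‖c‖²`,
the second vanishes (`∫Φ₂ = 0`). Hence `E = L⁻³ conj(∫_Λ w^per e_k)‖c‖² + E_{Φ₂}`, `Re ∫_Λ w^per e_k = potCos`,
`|Re E_{Φ₂}| ≤ ‖w‖₁/L³‖Φ₂‖²` (`WF.abs_exchCoef_re_le`), `‖Φ‖² = ‖c‖² + ‖Φ₂‖²` (orthogonality) and `(m+1)‖c‖² = n₀`.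
Elementary; nothing is cited.
-/

noncomputable section

open scoped BigOperators ENNReal ComplexConjugate
open Filter MeasureTheory

namespace Summit.AtomisticToContinuum.BoseEinsteinCondensation.Cruxes.PeriodicIRBound.TwoSectorGdTransfer

open Literature.MathematicalPhysics.QuantumManyBody.BoseGas
open Summit.AtomisticToContinuum.BoseEinsteinCondensation.Cruxes.PeriodicIRBound.LinearPhFloorWagner
open Summit.AtomisticToContinuum.BoseEinsteinCondensation.Cruxes.PeriodicIRBound.LinearPhFloorWagner.WF

namespace ExchangeBound

variable {m : ℕ} {L : ℝ} {w : ℝ → ℝ≥0∞} {Φ : Config (m + 1) → ℂ}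

/-- `(x :: Y) without particle 1 = x :: tail Y`. [folklore] -/
theorem removeNth_one_cons_eb (x : Space) (Y : Config (m + 1)) :
    Fin.removeNth 1 (Matrix.vecCons x Y : Config (m + 2)) = Matrix.vecCons x (Fin.tail Y) := by
  rw [← Fin.succ_zero_eq_one, removeNth_succ_vecCons, Fin.removeNth_zero]

/-- Relabelling `0 ↔ 1` and dropping particle `1` is dropping particle `0`. [folklore] -/
theorem removeNth_one_comp_swap {α : Type*} (Z : Fin (m + 2) → α) :
    Fin.removeNth 1 (Z ∘ ⇑(Equiv.swap (0 : Fin (m + 2)) 1)) = Fin.tail Z := by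
  funext i
  refine Fin.cases ?_ (fun j => ?_) i
  · simp [Fin.removeNth, Fin.tail]
  · simp only [Fin.removeNth, Fin.tail, Function.comp_apply, ← Fin.succ_zero_eq_one, Fin.succ_succAbove_succ,
      Fin.succAbove_zero]
    rw [Equiv.swap_apply_of_ne_of_ne (Fin.succ_ne_zero _) (Fin.succ_zero_eq_one ▸ Fin.succ_succ_ne_one j)]

/-- Relabelling `0 ↔ 1` does not move the particles `2, 3, …`. [folklore] -/
theorem tail_tail_comp_swap {α : Type*} (Z : Fin (m + 2) → α) :
    Fin.tail (Fin.tail (Z ∘ ⇑(Equiv.swap (0 : Fin (m + 2)) 1))) = Fin.tail (Fin.tail Z) := by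
  funext j
  simp only [Fin.tail, Function.comp_apply]
  rw [Equiv.swap_apply_of_ne_of_ne (Fin.succ_ne_zero _) (Fin.succ_succ_ne_one j)]

/-- `c(W') = L^{-3/2} ∫_Λ Φ(s :: W') ds` (`φ_0 ≡ L^{-3/2}`). [folklore] -/
theorem sliceCoef_zero_eq (L : ℝ) (Φ : Config (m + 1) → ℂ) (W' : Config m) :
    sliceCoef L 0 Φ W' = ((Real.sqrt (L ^ 3))⁻¹ : ℂ) * ∫ s in cell L, Φ (Matrix.vecCons s W') := by
  simp only [sliceCoef, planeWaveMode_zero, map_inv₀, Complex.conj_ofReal]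
  exact integral_const_mul _ _

/-- The fluctuation has zero slot-`0` mean: `∫_Λ (Φ(s::W') − L^{-3/2} c(W')) ds = 0`. [folklore] -/
theorem integral_cell_slotFluct (hL : 0 < L) (hΦ : Continuous Φ) (W' : Config m) :
    ∫ s in cell L, (Φ (Matrix.vecCons s W') - ((Real.sqrt (L ^ 3))⁻¹ : ℂ) * sliceCoef L 0 Φ W') = 0 := by
  have h1 : IntegrableOn (fun s : Space => Φ (Matrix.vecCons s W')) (cell L) volume :=
    integrableOn_cell (hΦ.comp (continuous_id.matrixVecCons continuous_const))
  have h3 : (((L ^ 3 : ℝ)) : ℂ) * ((Real.sqrt (L ^ 3))⁻¹ : ℂ) * ((Real.sqrt (L ^ 3))⁻¹ : ℂ) = 1 := by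
    rw [mul_assoc, sqrt_inv_mul_sqrt_inv hL, ← Complex.ofReal_mul, mul_inv_cancel₀ (pow_ne_zero 3 hL.ne'),
      Complex.ofReal_one]
  rw [integral_sub h1 (integrableOn_cell continuous_const), setIntegral_const, Measure.real, volume_cell,
    ← ENNReal.ofReal_pow hL.le, ENNReal.toReal_ofReal (by positivity), sliceCoef_zero_eq, Complex.real_smul,
    ← mul_assoc, ← mul_assoc, h3, one_mul, sub_self]

/-- The same for the fluctuation written as a function on `Λ^{m+1}`, `Φ₂ = Φ − φ_0 ⊗ c`. [folklore] -/
theorem integral_cell_slotFluct_vecCons (hL : 0 < L) (hΦ : Continuous Φ) (W' : Config m) :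
    ∫ s in cell L, (fun X : Config (m + 1) => Φ X - planeWaveMode L 0 (X 0) * sliceCoef L 0 Φ (Fin.tail X))
      (Matrix.vecCons s W') = 0 := by
  simp only [Matrix.cons_val_zero, tail_vecCons_tk, planeWaveMode_zero]
  exact integral_cell_slotFluct hL hΦ W'

/-- The fluctuation `Φ₂ = Φ − φ_0 ⊗ c` is continuous. [folklore] -/
theorem continuous_slotFluct (L : ℝ) (hΦ : Continuous Φ) :
    Continuous fun X : Config (m + 1) => Φ X - planeWaveMode L 0 (X 0) * sliceCoef L 0 Φ (Fin.tail X) :=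
  hΦ.sub (((continuous_planeWaveMode L 0).comp (continuous_apply 0)).mul
    ((PotCross.continuous_sliceCoef L 0 hΦ).comp (continuous_pi fun i => continuous_apply i.succ)))

/-- `w^per(Z₀ − Z₁)·F` is integrable on `Λ^{m+2}` for continuous `F` (`w^per(Z₀−Z₁) ≤ W ∈ L¹(Λ^{m+2})`, `F` bounded on
the cell). [folklore] -/
theorem integrable_potPair_mul (hL : 0 < L) (hw : Measurable w) (hint : (∫⁻ z : Space, w ‖z‖) ≠ ⊤)
    {F : Config (m + 2) → ℂ} (hF : Continuous F) :
    Integrable (fun Z : Config (m + 2) => ((periodizedPotential w L (Z 0 - Z 1)).toReal : ℂ) * F Z)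
      ((volume : Measure (Config (m + 2))).restrict (cellN (m + 2) L)) := by
  obtain ⟨C, -, hC⟩ := exists_bound_on_cellN L hF
  have hV : Measurable fun Z : Config (m + 2) => periodizedPotential w L (Z 0 - Z 1) :=
    measurable_periodizedPotential_pair hw L 0 1
  have hfin : ∫⁻ Z in cellN (m + 2) L, periodizedPotential w L (Z 0 - Z 1) ≠ ⊤ :=
    ne_top_of_le_ne_top (lintegral_cellN_periodicInteraction_ne_top hL hw hint (m + 2))
      (lintegral_mono fun Z => periodizedPotential_le_periodicInteraction w L Z Fin.zero_lt_one)
  exact (integrable_toReal_of_lintegral_ne_top hV.aemeasurable hfin).ofReal.mul_bdd hF.aestronglyMeasurable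
    (ae_restrict_of_forall_mem (measurableSet_cellN (m + 2) L) hC)

/-- **The plane wave is an eigenfunction of convolution by the periodised weight** (integration in the second variable):
`∫_Λ w^per(y − x) conj φ_k(x) φ_k(y) dy = L⁻³ ∫_Λ w^per(z) e_k(z) dz` for every `x` (`conj e_k(x) e_k(y) = e_k(y − x)` and
the cell integral of the `Lℤ³`-periodic `w^per e_k` is shift invariant). [folklore] -/
theorem kernel_right (hL : 0 < L) (w : ℝ → ℝ≥0∞) (k : Fin 3 → ℤ) (x : Space) :
    ∫ y in cell L, ((periodizedPotential w L (y - x)).toReal : ℂ) * (conj (planeWaveMode L k x) * planeWaveMode L k y) =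
      (((L ^ 3)⁻¹ : ℝ) : ℂ) * ∫ z in cell L, ((periodizedPotential w L z).toReal : ℂ) * cellWave L k z := by
  have hs := sqrt_inv_mul_sqrt_inv hL
  have hper : ∀ (u : Space) (j : Fin 3),
      (fun z => ((periodizedPotential w L z).toReal : ℂ) * cellWave L k z) (u + EuclideanSpace.single j L) =
        (fun z => ((periodizedPotential w L z).toReal : ℂ) * cellWave L k z) u := by
    intro u j
    simp only [single_eq_latticeVec, periodizedPotential_add_latticeVec, cellWave_add_latticeVec hL.ne']
  have hpt : ∀ y : Space, ((periodizedPotential w L (y - x)).toReal : ℂ) *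
      (conj (planeWaveMode L k x) * planeWaveMode L k y) =
      (((L ^ 3)⁻¹ : ℝ) : ℂ) * (fun z => ((periodizedPotential w L z).toReal : ℂ) * cellWave L k z) (y + -x) := by
    intro y
    have h1 : cellWave L k y = cellWave L k (y - x) * cellWave L k x := by rw [← cellWave_add, sub_add_cancel]
    have h2 : conj (cellWave L k x) * cellWave L k x = 1 := by rw [Complex.conj_mul', norm_cellWave]; simp
    rw [← sub_eq_add_neg, planeWaveMode_eq, planeWaveMode_eq, map_mul, map_inv₀, Complex.conj_ofReal, h1]
    linear_combination (((periodizedPotential w L (y - x)).toReal : ℂ) * cellWave L k (y - x) *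
      (conj (cellWave L k x) * cellWave L k x)) * hs +
      (((periodizedPotential w L (y - x)).toReal : ℂ) * cellWave L k (y - x) * (((L ^ 3)⁻¹ : ℝ) : ℂ)) * h2
  rw [integral_congr_ae (ae_of_all _ hpt), integral_const_mul,
    setIntegral_cell_comp_add_of_periodic hL (H := fun z => ((periodizedPotential w L z).toReal : ℂ) * cellWave L k z)
      hper (-x)]

/-- The same in the first variable: `∫_Λ w^per(x − y) conj φ_k(x) φ_k(y) dx = L⁻³ conj(∫_Λ w^per e_k)` for every `y`
(complex conjugate of `kernel_right`). [folklore] -/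
theorem kernel_left (hL : 0 < L) (w : ℝ → ℝ≥0∞) (k : Fin 3 → ℤ) (y : Space) :
    ∫ x in cell L, ((periodizedPotential w L (x - y)).toReal : ℂ) * (conj (planeWaveMode L k x) * planeWaveMode L k y) =
      (((L ^ 3)⁻¹ : ℝ) : ℂ) * conj (∫ z in cell L, ((periodizedPotential w L z).toReal : ℂ) * cellWave L k z) := by
  calc ∫ x in cell L, ((periodizedPotential w L (x - y)).toReal : ℂ) * (conj (planeWaveMode L k x) * planeWaveMode L k y)
      = ∫ x in cell L, conj (((periodizedPotential w L (x - y)).toReal : ℂ) *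
          (conj (planeWaveMode L k y) * planeWaveMode L k x)) :=
        integral_congr_ae (ae_of_all _ fun x => by
          simp only [map_mul, Complex.conj_ofReal, Complex.conj_conj]; ring)
    _ = (((L ^ 3)⁻¹ : ℝ) : ℂ) * conj (∫ z in cell L, ((periodizedPotential w L z).toReal : ℂ) * cellWave L k z) := by
        rw [integral_conj, kernel_right hL w k y, map_mul, Complex.conj_ofReal]

/-- `Re ∫_Λ w^per(z) e_k(z) dz = potCos w L (2πk/L)` (the integrand is integrable: `w^per ∈ L¹(Λ)`, `|e_k| = 1`).
[folklore] -/
theorem re_potWave (hL : 0 < L) (hw : Measurable w) (hint : (∫⁻ z : Space, w ‖z‖) ≠ ⊤) (k : Fin 3 → ℤ) :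
    (∫ z in cell L, ((periodizedPotential w L z).toReal : ℂ) * cellWave L k z).re =
      potCos w L (latticeVec (2 * Real.pi / L) k) := by
  have hfin : ∫⁻ z in cell L, periodizedPotential w L z ≠ ⊤ := by
    have h := WF.lintegral_cell_periodizedPotential_sub hL hw (0 : Space)
    simp only [sub_zero] at h
    rw [h]
    exact hint
  have hVi : Integrable (fun z => ((periodizedPotential w L z).toReal : ℂ) * cellWave L k z)
      ((volume : Measure Space).restrict (cell L)) :=
    (integrable_toReal_of_lintegral_ne_top (measurable_periodizedPotential_tk hw L).aemeasurable hfin).ofReal.mul_bdd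
      (continuous_cellWave L k).aestronglyMeasurable (ae_of_all _ fun z => (norm_cellWave L k z).le)
  have h := integral_re hVi
  simp only [RCLike.re_to_complex] at h
  rw [← h]
  unfold potCos
  refine integral_congr_ae (ae_of_all _ fun z => ?_)
  dsimp only
  have harg : 2 * (Real.pi : ℂ) * Complex.I * ((∑ j, ((k j : ℤ) : ℝ) * z j : ℝ) : ℂ) / (L : ℂ) =
      ((2 * Real.pi * (∑ j, ((k j : ℤ) : ℝ) * z j) / L : ℝ) : ℂ) * Complex.I := by
    push_cast
    ring
  have hsum : 2 * Real.pi * (∑ j, ((k j : ℤ) : ℝ) * z j) / L = ∑ j, (latticeVec (2 * Real.pi / L) k) j * z j := by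
    simp only [latticeVec, WithLp.ofLp_toLp]
    rw [Finset.mul_sum, Finset.sum_div]
    exact Finset.sum_congr rfl fun j _ => by ring
  rw [Complex.re_ofReal_mul, cellWave_apply, harg, Complex.exp_ofReal_mul_I_re, hsum]


/-- **The fluctuation cross term vanishes**: for continuous `Ψ` with zero slot-`0` mean, continuous `c` and a continuous
`F` with `F(t :: Y) = conj φ_k(Y₀) φ_k(t) · conj(L^{-3/2}c(tail Y)) Ψ(Y)`: `∫_{Λ^{m+2}} w^per(Z₀−Z₁) F(Z) dZ = 0` (peel `Z₀`;
the eigenfunction property leaves `const · ∫_{s} Ψ(s :: W') = 0`). [folklore] -/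
theorem cross_fluct_eq_zero (hL : 0 < L) (hw : Measurable w) (hint : (∫⁻ z : Space, w ‖z‖) ≠ ⊤) (k : Fin 3 → ℤ)
    {Ψ : Config (m + 1) → ℂ} {c : Config m → ℂ} {F : Config (m + 2) → ℂ} (hΨ : Continuous Ψ) (hc : Continuous c)
    (hF : Continuous F) (hFY : ∀ (t : Space) (Y : Config (m + 1)), F (Matrix.vecCons t Y) =
      conj (planeWaveMode L k (Y 0)) * planeWaveMode L k t * (conj (((Real.sqrt (L ^ 3))⁻¹ : ℂ) * c (Fin.tail Y)) * Ψ Y))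
    (hΨ0 : ∀ W' : Config m, ∫ s in cell L, Ψ (Matrix.vecCons s W') = 0) :
    ∫ Z in cellN (m + 2) L, ((periodizedPotential w L (Z 0 - Z 1)).toReal : ℂ) * F Z = 0 := by
  have htail : Continuous fun Y : Config (m + 1) => Fin.tail Y := continuous_pi fun i => continuous_apply i.succ
  rw [integral_cellN_succ L (integrable_potPair_mul hL hw hint hF)]
  have hpt : ∀ (Y : Config (m + 1)) (t : Space), ((periodizedPotential w L
      ((Matrix.vecCons t Y : Config (m + 2)) 0 - (Matrix.vecCons t Y : Config (m + 2)) 1)).toReal : ℂ) *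
        F (Matrix.vecCons t Y) =
      ((periodizedPotential w L (t - Y 0)).toReal : ℂ) * (conj (planeWaveMode L k (Y 0)) * planeWaveMode L k t) *
        (conj (((Real.sqrt (L ^ 3))⁻¹ : ℂ) * c (Fin.tail Y)) * Ψ Y) := by
    intro Y t
    simp only [Matrix.cons_val_zero, Matrix.cons_val_one, hFY]
    ring
  simp_rw [hpt, integral_mul_const, kernel_right hL w k]
  have hG : Continuous fun Y : Config (m + 1) =>
      ((((L ^ 3)⁻¹ : ℝ) : ℂ) * ∫ z in cell L, ((periodizedPotential w L z).toReal : ℂ) * cellWave L k z) *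
        (conj (((Real.sqrt (L ^ 3))⁻¹ : ℂ) * c (Fin.tail Y)) * Ψ Y) :=
    continuous_const.mul ((Complex.continuous_conj.comp (continuous_const.mul (hc.comp htail))).mul hΨ)
  rw [integral_cellN_succ L (integrableOn_cellN hG L)]
  simp only [tail_vecCons_tk, integral_const_mul, hΨ0, mul_zero, integral_zero]

/-- **The mean cross term**: for continuous `Φ`, `c = sliceCoef L 0 Φ` and a continuous `F` with
`F((t :: Y) ∘ swap 0 1) = conj φ_k(t) φ_k(Y₀) · (L^{-3/2}c(tail Y)) conj Φ(Y)`: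
`∫_{Λ^{m+2}} w^per(Z₀−Z₁) F(Z) dZ = L⁻³ conj(∫_Λ w^per e_k)·‖c‖²` (relabel `0 ↔ 1`, peel `Z₀`; the eigenfunction property
leaves `L⁻³conj(∫w^per e_k) L^{-3/2}∫ c(W') conj Φ(s::W')`, and `L^{-3/2}∫_s conj Φ(s::W') = conj c(W')`). [folklore] -/
theorem cross_mean_eq (hL : 0 < L) (hw : Measurable w) (hint : (∫⁻ z : Space, w ‖z‖) ≠ ⊤) (k : Fin 3 → ℤ)
    (hΦ : Continuous Φ) {F : Config (m + 2) → ℂ} (hF : Continuous F)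
    (hFσ : ∀ (t : Space) (Y : Config (m + 1)), F (Matrix.vecCons t Y ∘ ⇑(Equiv.swap (0 : Fin (m + 2)) 1)) =
      conj (planeWaveMode L k t) * planeWaveMode L k (Y 0) *
        ((((Real.sqrt (L ^ 3))⁻¹ : ℂ) * sliceCoef L 0 Φ (Fin.tail Y)) * conj (Φ Y))) :
    ∫ Z in cellN (m + 2) L, ((periodizedPotential w L (Z 0 - Z 1)).toReal : ℂ) * F Z =
      (((L ^ 3)⁻¹ : ℝ) : ℂ) * conj (∫ z in cell L, ((periodizedPotential w L z).toReal : ℂ) * cellWave L k z) *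
        ((normSq L (sliceCoef L 0 Φ)).toReal : ℂ) := by
  have hcc : Continuous (sliceCoef L 0 Φ) := PotCross.continuous_sliceCoef L 0 hΦ
  have htail : Continuous fun Y : Config (m + 1) => Fin.tail Y := continuous_pi fun i => continuous_apply i.succ
  have hI : IntegrableOn (fun Z : Config (m + 2) => ((periodizedPotential w L (Z 0 - Z 1)).toReal : ℂ) *
      F (Z ∘ ⇑(Equiv.swap (0 : Fin (m + 2)) 1))) (cellN (m + 2) L) volume :=
    integrable_potPair_mul hL hw hint (hF.comp (continuous_pi fun i => continuous_apply _))
  -- relabel the particles `0 ↔ 1`, then peel `Z₀`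
  have h1 : ∀ Z : Config (m + 2), ((periodizedPotential w L ((Z ∘ ⇑(Equiv.swap (0 : Fin (m + 2)) 1)) 0 -
      (Z ∘ ⇑(Equiv.swap (0 : Fin (m + 2)) 1)) 1)).toReal : ℂ) * F (Z ∘ ⇑(Equiv.swap (0 : Fin (m + 2)) 1)) =
      ((periodizedPotential w L (Z 0 - Z 1)).toReal : ℂ) * F (Z ∘ ⇑(Equiv.swap (0 : Fin (m + 2)) 1)) := by
    intro Z
    simp only [Function.comp_apply, Equiv.swap_apply_left, Equiv.swap_apply_right,
      periodizedPotential_sub_comm w L (Z 1) (Z 0)]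
  rw [← integral_cellN_comp_perm L (Equiv.swap 0 1)
    (fun Z => ((periodizedPotential w L (Z 0 - Z 1)).toReal : ℂ) * F Z)]
  beta_reduce
  rw [integral_congr_ae (ae_of_all _ h1), integral_cellN_succ L hI]
  have hpt : ∀ (Y : Config (m + 1)) (t : Space), ((periodizedPotential w L
      ((Matrix.vecCons t Y : Config (m + 2)) 0 - (Matrix.vecCons t Y : Config (m + 2)) 1)).toReal : ℂ) *
        F (Matrix.vecCons t Y ∘ ⇑(Equiv.swap (0 : Fin (m + 2)) 1)) =
      ((periodizedPotential w L (t - Y 0)).toReal : ℂ) * (conj (planeWaveMode L k t) * planeWaveMode L k (Y 0)) *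
        ((((Real.sqrt (L ^ 3))⁻¹ : ℂ) * sliceCoef L 0 Φ (Fin.tail Y)) * conj (Φ Y)) := by
    intro Y t
    simp only [Matrix.cons_val_zero, Matrix.cons_val_one, hFσ]
    ring
  simp_rw [hpt, integral_mul_const, kernel_left hL w k]
  -- peel `Z₁`
  have hG : Continuous fun Y : Config (m + 1) =>
      ((((L ^ 3)⁻¹ : ℝ) : ℂ) * conj (∫ z in cell L, ((periodizedPotential w L z).toReal : ℂ) * cellWave L k z)) *
        ((((Real.sqrt (L ^ 3))⁻¹ : ℂ) * sliceCoef L 0 Φ (Fin.tail Y)) * conj (Φ Y)) :=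
    continuous_const.mul ((continuous_const.mul (hcc.comp htail)).mul (Complex.continuous_conj.comp hΦ))
  rw [integral_cellN_succ L (integrableOn_cellN hG L), ← integral_conj_mul_self_eq L hcc]
  simp only [tail_vecCons_tk, integral_const_mul, integral_conj]
  congr 1
  refine integral_congr_ae (ae_of_all _ fun W' => ?_)
  dsimp only
  rw [sliceCoef_zero_eq]
  simp only [map_mul, map_inv₀, Complex.conj_ofReal]
  ring

/-- **Mean/fluctuation decomposition of the exchange coefficient**: for continuous `Φ`, `c = sliceCoef L 0 Φ` and
`Φ₂ = Φ − φ_0 ⊗ c`, `E_Φ − E_{Φ₂} = L⁻³ conj(∫_Λ w^per e_k)·‖c‖²` (`E = ∫ w^per(Z₀−Z₁)B` by `WF.piece_pair`; `B_Φ − B_{Φ₂}` is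
the sum of the two cross terms pointwise). [folklore] -/
theorem exchCoef_sub_fluct (hL : 0 < L) (hw : Measurable w) (hint : (∫⁻ z : Space, w ‖z‖) ≠ ⊤) (k : Fin 3 → ℤ)
    (hΦ : Continuous Φ) :
    exchCoef w L k Φ - exchCoef w L k (fun X => Φ X - planeWaveMode L 0 (X 0) * sliceCoef L 0 Φ (Fin.tail X)) =
      (((L ^ 3)⁻¹ : ℝ) : ℂ) * conj (∫ z in cell L, ((periodizedPotential w L z).toReal : ℂ) * cellWave L k z) *
        ((normSq L (sliceCoef L 0 Φ)).toReal : ℂ) := by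
  have hΦ₂ := continuous_slotFluct L hΦ
  have hcc : Continuous (sliceCoef L 0 Φ) := PotCross.continuous_sliceCoef L 0 hΦ
  have htail : Continuous fun Y : Config (m + 1) => Fin.tail Y := continuous_pi fun i => continuous_apply i.succ
  have hφ : ∀ i : Fin (m + 2), Continuous fun Z : Config (m + 2) => planeWaveMode L k (Z i) :=
    fun i => (continuous_planeWaveMode L k).comp (continuous_apply i)
  have hV : ∀ Z : Config (m + 2), periodizedPotential w L (Z 0 - Z 1) ≤ periodicInteraction w L Z := fun Z =>
    periodizedPotential_le_periodicInteraction w L Z Fin.zero_lt_one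
  have hrm : ∀ j : Fin (m + 2), Continuous fun Z : Config (m + 2) => Fin.removeNth j Z := fun j => continuous_removeNth j
  -- the two cross factors
  obtain ⟨A, hA⟩ : ∃ A : Config (m + 2) → ℂ, A = fun Z => conj (planeWaveMode L k (Z 1)) * planeWaveMode L k (Z 0) *
      (planeWaveMode L 0 (Fin.removeNth 0 Z 0) * sliceCoef L 0 Φ (Fin.tail (Fin.removeNth 0 Z))) *
        conj (Φ (Fin.removeNth 1 Z)) := ⟨_, rfl⟩
  obtain ⟨B, hB⟩ : ∃ B : Config (m + 2) → ℂ, B = fun Z => conj (planeWaveMode L k (Z 1)) * planeWaveMode L k (Z 0) *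
      conj (planeWaveMode L 0 (Fin.removeNth 1 Z 0) * sliceCoef L 0 Φ (Fin.tail (Fin.removeNth 1 Z))) *
        (fun X => Φ X - planeWaveMode L 0 (X 0) * sliceCoef L 0 Φ (Fin.tail X)) (Fin.removeNth 0 Z) := ⟨_, rfl⟩
  have h0 : ∀ j : Fin (m + 2), Continuous fun Z : Config (m + 2) => planeWaveMode L 0 (Fin.removeNth j Z 0) :=
    fun j => (continuous_planeWaveMode L 0).comp ((continuous_apply 0).comp (hrm j))
  have hAc : Continuous A :=
    hA ▸ (((Complex.continuous_conj.comp (hφ 1)).fun_mul (hφ 0)).fun_mul ((h0 0).fun_mul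
      (hcc.comp (htail.comp (hrm 0))))).fun_mul (Complex.continuous_conj.comp (hΦ.comp (hrm 1)))
  have hBc : Continuous B :=
    hB ▸ (((Complex.continuous_conj.comp (hφ 1)).fun_mul (hφ 0)).fun_mul (Complex.continuous_conj.comp
      ((h0 1).fun_mul (hcc.comp (htail.comp (hrm 1)))))).fun_mul (hΦ₂.comp (hrm 0))
  have hpt : ∀ Z : Config (m + 2),
      ((periodizedPotential w L (Z 0 - Z 1)).toReal : ℂ) * exchFactor L k Φ Z -
        ((periodizedPotential w L (Z 0 - Z 1)).toReal : ℂ) *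
          exchFactor L k (fun X => Φ X - planeWaveMode L 0 (X 0) * sliceCoef L 0 Φ (Fin.tail X)) Z =
      ((periodizedPotential w L (Z 0 - Z 1)).toReal : ℂ) * A Z +
        ((periodizedPotential w L (Z 0 - Z 1)).toReal : ℂ) * B Z := by
    intro Z
    simp only [exchFactor, hA, hB, map_mul, map_sub]
    ring
  have hAσ : ∀ (t : Space) (Y : Config (m + 1)), A (Matrix.vecCons t Y ∘ ⇑(Equiv.swap (0 : Fin (m + 2)) 1)) =
      conj (planeWaveMode L k t) * planeWaveMode L k (Y 0) *
        ((((Real.sqrt (L ^ 3))⁻¹ : ℂ) * sliceCoef L 0 Φ (Fin.tail Y)) * conj (Φ Y)) := by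
    intro t Y
    simp only [hA, Function.comp_apply, Equiv.swap_apply_left, Equiv.swap_apply_right, removeNth_one_comp_swap,
      Fin.removeNth_zero, tail_tail_comp_swap, planeWaveMode_zero, Matrix.cons_val_zero, Matrix.cons_val_one,
      tail_vecCons_tk]
    ring
  have hBY : ∀ (t : Space) (Y : Config (m + 1)), B (Matrix.vecCons t Y) =
      conj (planeWaveMode L k (Y 0)) * planeWaveMode L k t *
        (conj (((Real.sqrt (L ^ 3))⁻¹ : ℂ) * sliceCoef L 0 Φ (Fin.tail Y)) *
          (fun X => Φ X - planeWaveMode L 0 (X 0) * sliceCoef L 0 Φ (Fin.tail X)) Y) := by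
    intro t Y
    simp only [hB, Matrix.cons_val_zero, Matrix.cons_val_one, removeNth_zero_vecCons, removeNth_one_cons_eb,
      tail_vecCons_tk, planeWaveMode_zero]
    ring
  rw [← piece_pair hL hw hint k hΦ, ← piece_pair hL hw hint k hΦ₂,
    ← integral_sub (integrable_piece hL hw hint k hΦ (measurable_periodizedPotential_pair hw L 0 1) hV)
      (integrable_piece hL hw hint k hΦ₂ (measurable_periodizedPotential_pair hw L 0 1) hV),
    integral_congr_ae (ae_of_all _ hpt),
    integral_add (integrable_potPair_mul hL hw hint hAc) (integrable_potPair_mul hL hw hint hBc),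
    cross_mean_eq hL hw hint k hΦ hAc hAσ,
    cross_fluct_eq_zero hL hw hint k hΦ₂ hcc hBc hBY (integral_cell_slotFluct_vecCons hL hΦ), add_zero]

/-- **Orthogonality of mean and fluctuation**: `‖Φ‖² = ‖c‖² + ‖Φ₂‖²` (`⟨φ_0 ⊗ c, Φ₂⟩ = ∫_{W'} conj(L^{-3/2}c)∫_s Φ₂ = 0` and
`‖φ_0 ⊗ c‖² = ‖c‖²`). [folklore] -/
theorem normSq_eq_add (hL : 0 < L) (hΦ : Continuous Φ) :
    normSq L Φ = normSq L (sliceCoef L 0 Φ) +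
      normSq L (fun X => Φ X - planeWaveMode L 0 (X 0) * sliceCoef L 0 Φ (Fin.tail X)) := by
  have hcc : Continuous (sliceCoef L 0 Φ) := PotCross.continuous_sliceCoef L 0 hΦ
  have hg : Continuous fun X : Config (m + 1) => planeWaveMode L 0 (X 0) * sliceCoef L 0 Φ (Fin.tail X) :=
    ((continuous_planeWaveMode L 0).comp (continuous_apply 0)).fun_mul
      (hcc.comp (continuous_pi fun i => continuous_apply i.succ))
  have horth : (∫ X in cellN (m + 1) L, conj (planeWaveMode L 0 (X 0) * sliceCoef L 0 Φ (Fin.tail X)) *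
      (Φ X - planeWaveMode L 0 (X 0) * sliceCoef L 0 Φ (Fin.tail X))).re = 0 := by
    rw [integral_cellN_succ L (integrableOn_cellN (f := fun X : Config (m + 1) =>
      conj (planeWaveMode L 0 (X 0) * sliceCoef L 0 Φ (Fin.tail X)) * (Φ X - planeWaveMode L 0 (X 0) *
        sliceCoef L 0 Φ (Fin.tail X))) ((Complex.continuous_conj.comp hg).fun_mul (hΦ.sub hg)) L)]
    simp only [Matrix.cons_val_zero, tail_vecCons_tk, planeWaveMode_zero, integral_const_mul, integral_cell_slotFluct hL hΦ,
      mul_zero, integral_zero, Complex.zero_re]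
  have hg₁ : normSq L (fun X : Config (m + 1) => planeWaveMode L 0 (X 0) * sliceCoef L 0 Φ (Fin.tail X)) =
      normSq L (sliceCoef L 0 Φ) := by
    have hL3 : ENNReal.ofReal L ^ 3 ≠ 0 := pow_ne_zero _ (ENNReal.ofReal_pos.2 hL).ne'
    unfold normSq
    rw [lintegral_cellN_succ L (hg.measurable.nnnorm.coe_nnreal_ennreal.pow_const _)]
    refine lintegral_congr fun W' => ?_
    simp only [Matrix.cons_val_zero, tail_vecCons_tk, nnnorm_mul, ENNReal.coe_mul, mul_pow,
      nnnorm_planeWaveMode_sq_tk hL, setLIntegral_const, volume_cell]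
    rw [mul_comm, ← mul_assoc, ENNReal.mul_inv_cancel hL3 (ENNReal.pow_ne_top ENNReal.ofReal_ne_top), one_mul]
  have key := normSq_add_of_re_nonneg L
    (g := fun X : Config (m + 1) => Φ X - planeWaveMode L 0 (X 0) * sliceCoef L 0 Φ (Fin.tail X)) hg (hΦ.sub hg)
    le_rfl horth
  simp only [add_sub_cancel, ENNReal.ofReal_zero, mul_zero, add_zero] at key
  rw [← hg₁, ← key]

/-- `n₀ = (m+1)‖c‖²` in `ℝ` (`a_0Φ = √(m+1)·c`, `WF.sliceCoef_eq_modeAn`, `WF.normSq_modeAn_eq_cellOccupation`). [folklore] -/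
theorem toReal_cellOccupation_zero (L : ℝ) (Φ : Config (m + 1) → ℂ) :
    (cellOccupation (m + 1) L (planeWaveMode L 0) Φ).toReal = ((m : ℝ) + 1) * (normSq L (sliceCoef L 0 Φ)).toReal := by
  have h : modeAn L (planeWaveMode L 0) Φ = fun Y => ((Real.sqrt (m + 1) : ℝ) : ℂ) * sliceCoef L 0 Φ Y := by
    funext Y
    rw [sliceCoef_eq_modeAn, ← mul_assoc, mul_inv_cancel₀ (sqrt_cast_ne_zero m), one_mul]
  rw [← normSq_modeAn_eq_cellOccupation, h, normSq_const_mul, ENNReal.toReal_mul, coe_nnnorm_sq_eq_ofReal,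
    ENNReal.toReal_ofReal (sq_nonneg _), Complex.norm_real, Real.norm_of_nonneg (Real.sqrt_nonneg _),
    Real.sq_sqrt (by positivity)]

end ExchangeBound

open ExchangeBound in
/-- **Stub S11a of the v11 skeleton (`SOFT-LOCATION.md` Step 3): the exchange coefficient is condensate-dominated**,
`(m+1)·Re(exchCoef w L k Φ) ≥ potCos·n₀/L³ − ‖w‖₁((m+1)‖Φ‖² − n₀)/L³` for measurable integrable `w`, `L > 0`, every mode
`k` and every core `Φ` (only continuity of `Φ` is used). [folklore] -/
theorem stub_exchangeCondensateBound : ExchangeCondensateBound := by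
  intro w hw hint m L hL k Φ hΦ
  have hΦc : Continuous Φ := hΦ.contDiff.continuous
  have hcc : Continuous (sliceCoef L 0 Φ) := PotCross.continuous_sliceCoef L 0 hΦc
  have hΦ₂c := continuous_slotFluct L hΦc
  have hN : (normSq L Φ).toReal = (normSq L (sliceCoef L 0 Φ)).toReal +
      (normSq L (fun X => Φ X - planeWaveMode L 0 (X 0) * sliceCoef L 0 Φ (Fin.tail X))).toReal := by
    rw [normSq_eq_add hL hΦc, ENNReal.toReal_add (normSq_ne_top L hcc) (normSq_ne_top L hΦ₂c)]
  have hE : (exchCoef w L k Φ).re = (L ^ 3)⁻¹ * potCos w L (latticeVec (2 * Real.pi / L) k) *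
      (normSq L (sliceCoef L 0 Φ)).toReal +
        (exchCoef w L k (fun X => Φ X - planeWaveMode L 0 (X 0) * sliceCoef L 0 Φ (Fin.tail X))).re := by
    rw [eq_add_of_sub_eq (exchCoef_sub_fluct hL hw hint k hΦc), Complex.add_re, Complex.re_mul_ofReal,
      Complex.re_ofReal_mul, Complex.conj_re, re_potWave hL hw hint k]
  have key := mul_le_mul_of_nonneg_left (abs_le.1 (abs_exchCoef_re_le hL hw hint k hΦ₂c)).1
    (by positivity : (0 : ℝ) ≤ (m : ℝ) + 1)
  rw [toReal_cellOccupation_zero L Φ, hN, hE]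
  calc _ = ((m : ℝ) + 1) * ((L ^ 3)⁻¹ * potCos w L (latticeVec (2 * Real.pi / L) k) *
        (normSq L (sliceCoef L 0 Φ)).toReal) + ((m : ℝ) + 1) * -(wL1 w / L ^ 3 *
          (normSq L fun X => Φ X - planeWaveMode L 0 (X 0) * sliceCoef L 0 Φ (Fin.tail X)).toReal) := by ring
    _ ≤ ((m : ℝ) + 1) * ((L ^ 3)⁻¹ * potCos w L (latticeVec (2 * Real.pi / L) k) *
        (normSq L (sliceCoef L 0 Φ)).toReal) + ((m : ℝ) + 1) *
          (exchCoef w L k fun X => Φ X - planeWaveMode L 0 (X 0) * sliceCoef L 0 Φ (Fin.tail X)).re :=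
      add_le_add le_rfl key
    _ = _ := by ring


end Summit.AtomisticToContinuum.BoseEinsteinCondensation.Cruxes.PeriodicIRBound.TwoSectorGdTransfer

end
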